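import Literature.AnabelianGeometry.EtaleTheta.Discharge.Sec2HasMuLIffMuInKModels
import Literature.AnabelianGeometry.EtaleTheta.Discharge.Sec2CyclotomeModOneOfTrivialActions
import HarnessLib

/-!
# [EtTh] Rmk. 2.6.1's hypothesis «`μ_l ⊆ K`» ⟺ `HasMuL` at the untwisted Krull model `κ′` — the NON-VACUOUS instance (`l ∣ p − 1`):
# a cyclotome datum EXISTS, the cover of record has `HasMuL`, and the abstract equivalence FIRES with both sides true (proof-only)

S. Mochizuki, *The étale theta function and its Frobenioid-theoretic manifestations*, Publ. RIMS **45** (2009) [EtTh], §2: Rmk. 2.6.1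
p. 40 («Suppose, for simplicity, that `K` contains a primitive `l`-th root of unity. Then …»), Def. 2.13 p. 46 (the cyclotome
`μ_N ≅ (l·Δ_Θ) ⊗ ℤ/N`), Cor. 2.9 p. 43 [cite: MochizukiEtTh2009, Rmk 2.6.1 p.40]; `μ_l(ℚ̄_p) ⊆ ℚ_p ⟺ l ∣ p − 1` for odd `l`
[cite: Serre1973, Ch. II §3.1 Prop. 7].

Cell abc-iut, layer L2, seat abc-iut-w6-d050 (gen 5), dag WAKE row (w3) «HASMUL@κ′ NON-VACUOUS» (abc-iut-L2-lead (gen 6) R802/R844; the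
natural row (a) named by abc-iut-L2-t10 g7 at close: «HasMuL ⟺ μ_l ⊆ K at κ′ NON-VACUOUSLY — K10's cover + `hμ_iff_coe_muN_mem_K` with
p475618/p477006's datum»).  PROOF-ONLY (0 definitions), every input BY NAME: abc-iut-L2-t10's abstract equivalence
`ThetaSetting.hμ_iff_coe_muN_mem_K` (p470982: given a cyclotome datum `μ : CyclotomeMod 1 l`, «`Π^tp_X` acts trivially on `Δ_Θ/l·Δ_Θ`»
⟺ «`μ_l(ℚ̄_p) ⊆ K`»), its K7/K10 theorem `conj_commutator_mem_lDeltaTheta_inversionModelκ'` (`hμ` HOLDS at `κ′` for every `l`: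
`(Π^tp_X)^Θ` centralises `Δ_Θ`), the κ′ cover of record with `HasMuL` (`exists_temperedCoverData_hasMuL_cor29_inversionModelκ'`, K8/K10 v2),
the cyclotome datum at `κ′` (`nonempty_cyclotomeMod_one_inversionModelκ'_of`, p475618 — exists iff `l ∣ p − 1 ∨ (p, l) = (2, 2)`), and K12
`hμK_modelκ'_iff_of_odd` (`μ_l ⊆ ℚ_p ⟺ l ∣ p − 1`).  The companion file `Sec2HasMuLIffMuInKModels` recorded the NEGATIVE side at `κ′`
(odd `l ∤ p − 1`: `HasMuL` holds, `μ_l ⊄ K`, no datum — the cyclotome hypothesis of the equivalence is essential); THIS file records the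
POSITIVE, non-vacuous side:
* `coe_muN_mem_K_inversionModelκ'_of_cyclotomeMod` — **a cyclotome datum `(1, l)` at `κ′` FORCES `μ_l(ℚ̄_p) ⊆ K = ℚ_p`**: the
  equivalence USED left-to-right with its left side the theorem `hμ@κ′` (a second, Rmk-2.6.1 route to K11's necessity
  `dvd_pred_of_cyclotomeMod_one_inversionModelκ'`: odd `l` with a datum ⇒ `l ∣ p − 1`);
* **`exists_cyclotomeMod_cover_hasMuL_iff_inversionModelκ'_of_dvd`** — for odd `l ∣ p − 1`: a datum `μ : CyclotomeMod 1 l` EXISTS at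
  `κ′`, THE cusp-law cover `T` on `Π^tp_C(inversionModelκ′)` realising the κ′ cover-data axioms EXISTS with `T.HasMuL`, `μ_l ⊆ K` HOLDS,
  and «`T.HasMuL ⟺ μ_l ⊆ K`» holds with BOTH SIDES TRUE — Rmk. 2.6.1's hypothesis at `κ′` is inhabited non-vacuously exactly on
  `l ∣ p − 1`, the tight locus of the cyclotome datum (K11).
HONEST LIMITS: semi-synthetic model (untwisted Krull root with one synthetic cusp) = consistency evidence for the typed interface only;
nothing of [EtTh] asserted; no side taken on [IUTchIII] Cor. 3.12; typed ≠ proved.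
-/

noncomputable section

namespace Literature.AnabelianGeometry.EtaleTheta.SettingModel

open Literature.AnabelianGeometry.SemiGraphs ThetaCovers

variable (p : ℕ) [Fact p.Prime]

/-- **A cyclotome datum `(1, l)` at `κ′` forces `μ_l(ℚ̄_p) ⊆ K`** — abc-iut-L2-t10's equivalence `hμ_iff_coe_muN_mem_K` used with its
left side the THEOREM `hμ@κ′` (`conj_commutator_mem_lDeltaTheta_inversionModelκ'`: `(Π^tp_X)^Θ` centralises `Δ_Θ`).
[cite: MochizukiEtTh2009, Rmk 2.6.1 p.40] -/
theorem coe_muN_mem_K_inversionModelκ'_of_cyclotomeMod {l : ℕ+}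
    (μ : (MuTwoSetting.inversionModelκ' p).toThetaSetting.CyclotomeMod 1 l) :
    ∀ ζ : MuN p l, (((ζ : (PadicAlgCl p)ˣ)) : PadicAlgCl p) ∈ (MuTwoSetting.inversionModelκ' p).K :=
  (ThetaSetting.hμ_iff_coe_muN_mem_K μ).mp fun σ a ha => conj_commutator_mem_lDeltaTheta_inversionModelκ' p l σ a ha

/-- Hence, for ODD `l`: **a cyclotome datum `(1, l)` at `κ′` forces `l ∣ p − 1`** (K12 `hμK_modelκ'_iff_of_odd`) — K11's necessity half
re-derived through Rmk. 2.6.1's hypothesis route. [cite: Serre1973, Ch. II §3.1 Prop. 7] -/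
theorem dvd_pred_of_cyclotomeMod_one_inversionModelκ' {l : ℕ+} (hodd : Odd (l : ℕ))
    (μ : (MuTwoSetting.inversionModelκ' p).toThetaSetting.CyclotomeMod 1 l) : (l : ℕ) ∣ p - 1 :=
  (hμK_modelκ'_iff_of_odd p l hodd).mp (coe_muN_mem_K_inversionModelκ'_of_cyclotomeMod p μ)

/-- **Rmk. 2.6.1's hypothesis at `κ′`, NON-VACUOUSLY** (the dag WAKE row (w3)): for odd `l ∣ p − 1` there are a cyclotome datum
`μ : CyclotomeMod 1 l` at `inversionModelκ′` and THE cusp-law `TemperedCoverData` `T` on its `Π^tp_C` realising the κ′ cover-data axioms,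
with `T.HasMuL` (K10 v2), `μ_l(ℚ̄_p) ⊆ K` (from the datum, previous theorem), and «`T.HasMuL ⟺ μ_l ⊆ K`» holding with BOTH SIDES TRUE.
[cite: MochizukiEtTh2009, Rmk 2.6.1 p.40] -/
theorem exists_cyclotomeMod_cover_hasMuL_iff_inversionModelκ'_of_dvd {l : ℕ+} (hodd : Odd (l : ℕ)) (hl : (l : ℕ) ∣ p - 1) :
    ∃ (_ : (MuTwoSetting.inversionModelκ' p).toThetaSetting.CyclotomeMod 1 l) (T : TemperedCoverData.{0} l),
      T.toCoverDataAx = ((cLevelDataInvκ' p).piCDataOf (toHatCκ p) (isProfiniteCompletion_toHatCκ p)).coverDataAx l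
        (nonempty_oncePuncturedData_modelκ' p).some (x := ()) trivial hodd
        (hIx_piCDataOf_toHatCκ p l hodd.pos (nonempty_oncePuncturedData_modelκ' p).some ())
        (inv_ell_piCDataOf_toHatCκ p l (nonempty_oncePuncturedData_modelκ' p).some)
        (inv_theta_piCDataOf_toHatCκ p l (nonempty_oncePuncturedData_modelκ' p).some) ∧
      T.HasMuL ∧ (∀ ζ : MuN p l, (((ζ : (PadicAlgCl p)ˣ)) : PadicAlgCl p) ∈ (MuTwoSetting.inversionModelκ' p).K) ∧
      (T.HasMuL ↔ ∀ ζ : MuN p l, (((ζ : (PadicAlgCl p)ˣ)) : PadicAlgCl p) ∈ (MuTwoSetting.inversionModelκ' p).K) := by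
  obtain ⟨μ⟩ := nonempty_cyclotomeMod_one_inversionModelκ'_of p l (Or.inl hl)
  obtain ⟨T, hT, hMuL, -⟩ :=
    exists_temperedCoverData_hasMuL_cor29_inversionModelκ' p hodd (nonempty_oncePuncturedData_modelκ' p).some
  have hK := coe_muN_mem_K_inversionModelκ'_of_cyclotomeMod p μ
  exact ⟨μ, T, hT, hMuL, hK, iff_of_true hMuL hK⟩

/-! ## v2 (append-only): the concrete instance `(p, l) = (7, 3)` (abc-iut-L2-lead R851) -/

/-- **The concrete instance `(p, l) = (7, 3)`** (`3` odd, `3 ∣ 7 − 1`): at `inversionModelκ′` over `ℚ_7` there are a cyclotome datum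
`μ : CyclotomeMod 1 3`, the cusp-law cover `T` with `T.HasMuL`, `μ_3(ℚ̄_7) ⊆ ℚ_7`, and «`T.HasMuL ⟺ μ_3 ⊆ K`» with both sides true —
by `decide` on the arithmetic side conditions. [cite: MochizukiEtTh2009, Rmk 2.6.1 p.40] -/
theorem exists_cyclotomeMod_cover_hasMuL_iff_inversionModelκ'_seven_three [Fact (Nat.Prime 7)] :
    ∃ (_ : (MuTwoSetting.inversionModelκ' 7).toThetaSetting.CyclotomeMod 1 (3 : ℕ+)) (T : TemperedCoverData.{0} ((3 : ℕ+) : ℕ)),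
      T.toCoverDataAx = ((cLevelDataInvκ' 7).piCDataOf (toHatCκ 7) (isProfiniteCompletion_toHatCκ 7)).coverDataAx ((3 : ℕ+) : ℕ)
        (nonempty_oncePuncturedData_modelκ' 7).some (x := ()) trivial (by decide)
        (hIx_piCDataOf_toHatCκ 7 ((3 : ℕ+) : ℕ) (by decide) (nonempty_oncePuncturedData_modelκ' 7).some ())
        (inv_ell_piCDataOf_toHatCκ 7 ((3 : ℕ+) : ℕ) (nonempty_oncePuncturedData_modelκ' 7).some)
        (inv_theta_piCDataOf_toHatCκ 7 ((3 : ℕ+) : ℕ) (nonempty_oncePuncturedData_modelκ' 7).some) ∧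
      T.HasMuL ∧ (∀ ζ : MuN 7 (3 : ℕ+), (((ζ : (PadicAlgCl 7)ˣ)) : PadicAlgCl 7) ∈ (MuTwoSetting.inversionModelκ' 7).K) ∧
      (T.HasMuL ↔ ∀ ζ : MuN 7 (3 : ℕ+), (((ζ : (PadicAlgCl 7)ˣ)) : PadicAlgCl 7) ∈ (MuTwoSetting.inversionModelκ' 7).K) :=
  exists_cyclotomeMod_cover_hasMuL_iff_inversionModelκ'_of_dvd 7 (l := 3) (by decide) (by decide)

end Literature.AnabelianGeometry.EtaleTheta.SettingModel

end
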